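import Summits.BirchSwinnertonDyer.BirchSwinnertonDyer.Theorems.KolyvaginRoadThreeRung347253a1
import Summits.BirchSwinnertonDyer.BirchSwinnertonDyer.Theorems.KolyvaginRoadThreeRung5709e1
import Summits.BirchSwinnertonDyer.BirchSwinnertonDyer.Theorems.KolyvaginRoadThreeMethod2Defs
import Summits.BirchSwinnertonDyer.Rank1Residual.X11b.Three.KolyvaginLine
import Literature.NumberTheory.EllipticCurves.HeegnerPointsOfConductorRationality
import Literature.NumberTheory.EllipticCurves.KolyvaginShaStructureDivisibility
import HarnessLib

/-!
# Route `KolyvaginRoadThree`, deciding crux `ZhangSharpFrameAtThreeHL` (item stmt-BirchSwinnertonDyer-19574):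
# the two BC5 RUNG stubs of the METHOD skeleton v2x LANDED BY NAME
# (cell `bsd-stepL`, OWNER seat `bsd-stepL-koly` g12; `--supports stmt-BirchSwinnertonDyer-19574`; the proofs are
# zhang3-p1's RUNG-BY-NAME kit `zhang3/skel/RungByName-19574.lean`, evidence #31 — one existing tree theorem each)

The registered skeleton v2x (koly g12) states its §4 rungs as CLOSED texts — published inputs + ONE attested Kolyvagin
certificate package ⟹ Kolyvagin's conjecture mod 3 at every Hoffstein–Luo frame of the pair — so that they can be
marked `stubs[].landed` (the v3…v2w rung asked the crux's instance OUTRIGHT and never could):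
* `stub_rung_347253a1` (NON-split 3; 347253a1 ⊗ ℚ(√−11), ℓ = 2, kit j249662 ∕ j250956) := zhang3-p1 g4's
  `Koly.Rung347253a1.rung_347253a1_of_cert` (p443855; the route's `tribunal_fit.witness`);
* `stub_rung_5709e1` (SPLIT 3; 5709e1 ⊗ ℚ(√−83), ℓ = 2, kit j250992; N = 5709, a₃ = +1, ∏c = 1) := zhang3-p1 g6's
  `Koly.Rung5709e1.stub_rung_5709e1_of_cert` (p463552) — the Kolyvagin lever where the cyclotomic road does not reach.
HONEST FRAMING. Every published input and the certificate package are BINDERS; nothing is booked; the attested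
certificates are kit computations (sha-manifested job outputs), not kernel facts. 0 defs, 0 facts, 0 `sorry`.
PARTITION: O2@3 (B10) × A1 × crux 19574 at the pairs (347253a1, ℚ(√−11)) and (5709e1, ℚ(√−83)) — types-the-object-of
(T3 rungs landed by name); closes: none (T7). [cite: McCallumLMS1991, §5 Cor. 5.6] [cite: GrossLMS1991, §3]
[cite: WZhang2014, Remark 5 and Thm. 10.2]
-/

noncomputable section

open scoped Classical

namespace Summit.BirchSwinnertonDyer.Rank1Residual.X11b.Three.Koly.Method2Rungs

open WeierstrassCurve NumberField IsDedekindDomain CategoryTheory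
  Literature.NumberTheory.EllipticCurves Literature.NumberTheory.EllipticCurves.ModularForms
  Literature.NumberTheory.GaloisRepresentations Module

open Summit.BirchSwinnertonDyer.Rank1Residual.X11b.Three.Koly.Method2
open Summit.BirchSwinnertonDyer.Rank1Residual.X11b.Three.Koly (PDiv)

/-- **Registered rung `stub_rung_347253a1` (v2x) BY NAME** — Kolyvagin's conjecture mod 3 at every HL frame of
347253a1 ⊗ ℚ(√−11) from the published inputs + ONE attested certificate package, by zhang3-p1's
`Koly.Rung347253a1.rung_347253a1_of_cert`. [cite: McCallumLMS1991, §5 Cor. 5.6] -/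
theorem stub_rung_347253a1 :
    ∀ (W : WeierstrassCurve ℚ), W = ⟨0, -1, 1, -10493, 412556⟩ →
      ∀ [W.IsElliptic] [W.IsGloballyMinimal] [NeZero (W.conductorNorm ℤ)],
      (∀ (K : Type) [Field K] [NumberField K], gross_zagier (W.conductorNorm ℤ) W K) →
      (∀ (K : Type) [Field K] [NumberField K], kolyvagin (W.conductorNorm ℤ) W K) →
      (∀ (K : Type) [Field K] [NumberField K], Kolyvagin1990_padicValNat_card_sha_le (W.conductorNorm ℤ) W K) →
      Skinner2016.thmC_padicValRat_bsd_rank_zero → rank_eq_analyticRank_of_analyticRank_le_one →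
      hasEntireLFunction_rat →
      (∀ (K : Type) [Field K] [NumberField K], heegnerPointOfConductor_one_galoisConj (W.conductorNorm ℤ) W K) →
      (∀ (K : Type) [Field K] [NumberField K],
        phi_heegnerPointOfConductor_mem_range_map_ringClassField (W.conductorNorm ℤ) W K) →
      (∀ (K : Type) [Field K] [NumberField K], exists_generator_ringClassGalOver K) →
      McCallum1991_pow_dvd_card_sha_primary_of_certificate →
      McCallum1991_padicValNat_card_sha_primary_add_le_of_globalDivisibility →
      ∀ (K₀ : Type) [Field K₀] [NumberField K₀] (Dt₀ : ModularParametrizationData W (W.conductorNorm ℤ)) (β₀ : ℤ)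
        (ι₀ : K₀ →+* ℂ), IsImaginaryQuadratic K₀ → NumberField.discr K₀ = -11 →
        SatisfiesHeegnerHypothesis (W.conductorNorm ℤ) K₀ →
        (W.quadraticTwist (NumberField.discr K₀ : ℚ)).entireLFunction 1 ≠ 0 → ¬ (3 : ℤ) ∣ Dt₀.c →
        Zhang2014.IsKolyvaginPrime (W.conductorNorm ℤ) W K₀ 3 2 →
        ∀ (d₀ : KolyvaginHeegnerData Dt₀ β₀ ι₀ 2), ¬ PDiv d₀ 3 1 →
      ∀ (K : Type) [Field K] [NumberField K] (Dt : ModularParametrizationData W (W.conductorNorm ℤ)) (β : ℤ)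
        (ι : K →+* ℂ), Summit.BirchSwinnertonDyer.Rank1Residual.ClassX11b W 3 → W.HasMultiplicativeReductionAtPrime 3 →
        Rank1Residual.Surj W 3 → Rank1Residual.Ram W 3 → ¬ 3 ∣ W.tamagawaProduct → IsImaginaryQuadratic K →
        Odd (NumberField.discr K) → SatisfiesHeegnerHypothesis (W.conductorNorm ℤ) K →
        (W.quadraticTwist (NumberField.discr K : ℚ)).entireLFunction 1 ≠ 0 → NumberField.discr K = -11 →
        (4 * (W.conductorNorm ℤ : ℤ)) ∣ β ^ 2 - NumberField.discr K → ¬ (3 : ℤ) ∣ Dt.c →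
        ∃ (n : ℕ) (d : KolyvaginHeegnerData Dt β ι n),
          KolyvaginDescent.KolSupp (Zhang2014.IsKolyvaginPrime (W.conductorNorm ℤ) W K 3) n ∧
            d.kolyvaginClass Nat.prime_three 1 ≠ 0 := by
  intro W hW _ _ _ hGZ hKo hB hSk hGZK hmod hrec h1 h2 hMc hMcU K₀ _ _ Dt₀ β₀ ι₀ hK₀ hd₀ hH₀ hLt₀ hc₀ hℓ₀ d₀ hcert₀
  exact Summit.BirchSwinnertonDyer.Rank1Residual.X11b.Three.Koly.Rung347253a1.rung_347253a1_of_cert W hW hGZ hKo hB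
    hSk hGZK hmod hrec h1 h2 hMc hMcU K₀ Dt₀ β₀ ι₀ hK₀ hd₀ hH₀ hLt₀ hc₀ hℓ₀ d₀ hcert₀

/-- **Registered rung `stub_rung_5709e1` (v2x) BY NAME** — Kolyvagin's conjecture mod 3 at every HL frame of the
SPLIT-at-3 pair 5709e1 ⊗ ℚ(√−83) from the published inputs + ONE attested certificate package, by zhang3-p1's
`Koly.Rung5709e1.stub_rung_5709e1_of_cert`. [cite: McCallumLMS1991, §5 Cor. 5.6] -/
theorem stub_rung_5709e1 :
    ∀ (W : WeierstrassCurve ℚ), W = ⟨0, 1, 1, -107, 392⟩ →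
      ∀ [W.IsElliptic] [W.IsGloballyMinimal] [NeZero (W.conductorNorm ℤ)],
      (∀ (K : Type) [Field K] [NumberField K], gross_zagier (W.conductorNorm ℤ) W K) →
      (∀ (K : Type) [Field K] [NumberField K], kolyvagin (W.conductorNorm ℤ) W K) →
      (∀ (K : Type) [Field K] [NumberField K], Kolyvagin1990_padicValNat_card_sha_le (W.conductorNorm ℤ) W K) →
      Skinner2016.thmC_padicValRat_bsd_rank_zero → rank_eq_analyticRank_of_analyticRank_le_one →
      hasEntireLFunction_rat →
      (∀ (K : Type) [Field K] [NumberField K], heegnerPointOfConductor_one_galoisConj (W.conductorNorm ℤ) W K) →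
      (∀ (K : Type) [Field K] [NumberField K],
        phi_heegnerPointOfConductor_mem_range_map_ringClassField (W.conductorNorm ℤ) W K) →
      (∀ (K : Type) [Field K] [NumberField K], exists_generator_ringClassGalOver K) →
      McCallum1991_pow_dvd_card_sha_primary_of_certificate →
      McCallum1991_padicValNat_card_sha_primary_add_le_of_globalDivisibility →
      ∀ (K₀ : Type) [Field K₀] [NumberField K₀] (Dt₀ : ModularParametrizationData W (W.conductorNorm ℤ)) (β₀ : ℤ)
        (ι₀ : K₀ →+* ℂ), IsImaginaryQuadratic K₀ → NumberField.discr K₀ = -83 →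
        SatisfiesHeegnerHypothesis (W.conductorNorm ℤ) K₀ →
        (W.quadraticTwist (NumberField.discr K₀ : ℚ)).entireLFunction 1 ≠ 0 → ¬ (3 : ℤ) ∣ Dt₀.c →
        Zhang2014.IsKolyvaginPrime (W.conductorNorm ℤ) W K₀ 3 2 →
        ∀ (d₀ : KolyvaginHeegnerData Dt₀ β₀ ι₀ 2), ¬ PDiv d₀ 3 1 →
      ∀ (K : Type) [Field K] [NumberField K] (Dt : ModularParametrizationData W (W.conductorNorm ℤ)) (β : ℤ)
        (ι : K →+* ℂ), Summit.BirchSwinnertonDyer.Rank1Residual.ClassX11b W 3 → W.HasMultiplicativeReductionAtPrime 3 →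
        Rank1Residual.Surj W 3 → Rank1Residual.Ram W 3 → ¬ 3 ∣ W.tamagawaProduct → IsImaginaryQuadratic K →
        Odd (NumberField.discr K) → SatisfiesHeegnerHypothesis (W.conductorNorm ℤ) K →
        (W.quadraticTwist (NumberField.discr K : ℚ)).entireLFunction 1 ≠ 0 → NumberField.discr K = -83 →
        (4 * (W.conductorNorm ℤ : ℤ)) ∣ β ^ 2 - NumberField.discr K → ¬ (3 : ℤ) ∣ Dt.c →
        ∃ (n : ℕ) (d : KolyvaginHeegnerData Dt β ι n),
          KolyvaginDescent.KolSupp (Zhang2014.IsKolyvaginPrime (W.conductorNorm ℤ) W K 3) n ∧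
            d.kolyvaginClass Nat.prime_three 1 ≠ 0 := by
  intro W hW _ _ _ hGZ hKo hB hSk hGZK hmod hrec h1 h2 hMc hMcU K₀ _ _ Dt₀ β₀ ι₀ hK₀ hd₀ hH₀ hLt₀ hc₀ hℓ₀ d₀ hcert₀
  exact Summit.BirchSwinnertonDyer.Rank1Residual.X11b.Three.Koly.Rung5709e1.stub_rung_5709e1_of_cert W hW hGZ hKo hB
    hSk hGZK hmod hrec h1 h2 hMc hMcU K₀ Dt₀ β₀ ι₀ hK₀ hd₀ hH₀ hLt₀ hc₀ hℓ₀ d₀ hcert₀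

end Summit.BirchSwinnertonDyer.Rank1Residual.X11b.Three.Koly.Method2Rungs

end
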